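import Literature.AlgebraicGeometry.Motives.TensorClosedSubschemeCentre
import Literature.AlgebraicGeometry.Resolution.ExceptionalHostSmooth
import Literature.AlgebraicGeometry.Resolution.StrictTransformPersistence
import HarnessLib

/-!
# Exceptional hosts of the blow-up of `X₁ ⊗ X₂` along a product centre

Topic `Literature/AlgebraicGeometry/Motives`; theorem-only. Continuation of
`Motives/TensorClosedSubschemeCentre` (the centre `𝓘 = pr₁⁻¹K₁·𝒪 + pr₂⁻¹K₂·𝒪` on
`X₁ ⊗ X₂`) and `Resolution/ExceptionalHostCharts`, `Resolution/ExceptionalHostSmooth` (hosts over a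
sub-centre of a regular-pair blowing up). For closed immersions `g₁ : Y₁ ↪ X₁`, `h : Y₂ ↪ X₂` landing
in `V(K₁)`, `V(K₂)` (`Kᵢ · 𝒪_{Yᵢ} = 0`), the sub-centre `i₀ = g₁ ⊗ h : Y₁ ⊗ Y₂ ↪ X₁ ⊗ X₂` lies in `V(𝓘)`, factors
through the "ruling" `L₀ = X₁ ◁ h : X₁ ⊗ Y₂ → X₁ ⊗ X₂` along which `𝓘` becomes the effective
Cartier divisor `pr₁⁻¹K₁`, and the regular-pair charts of `𝓘` cover `i₀(Y₁ ⊗ Y₂)`. Hence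
every hypothesis of the host files is met: for a blowing up `b : X' → X₁ ⊗ X₂` along `𝓘`, the
host `E = X' ×_{X₁ ⊗ X₂} (Y₁ ⊗ Y₂)` is flat and smooth of relative dimension `1` over `Y₁ ⊗ Y₂`
with a closed section, irreducible, a smooth projective variety, and `E ∖ σ → Y₁ ⊗ Y₂` has
polynomial charts. This is Shioda–Katsura's Thm. 1.7 (ii) for `X₁ = Xʳ⁺¹ₘ`, `Y₁ = Xʳₘ`,
`X₂ = X¹ₘ (⊗ W)`, `Y₂ = {pⱼ} (⊗ W)`: the exceptional divisors `Eⱼ → Bⱼ` are `ℙ¹`-bundles.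

## References

* T. Shioda, T. Katsura, On Fermat varieties, Tôhoku Math. J. 31 (1979) 97–115, §1 (1.4)–(1.6),
  Thm. 1.7. [ShiodaKatsura1979]
* W. Fulton, *Intersection Theory* (1998), proof of Lemma 2.4, B.6.9–B.6.10. [Fulton1998]
-/

noncomputable section

open CategoryTheory CategoryTheory.Limits AlgebraicGeometry MonoidalCategory TensorProduct

namespace Literature.AlgebraicGeometry.Motives

open Literature.AlgebraicGeometry.Resolution

variable {k : Type} [Field k] (X₁ X₂ : SchemeOver k) {Y₁ Y₂ : SchemeOver k} (g₁ : Y₁ ⟶ X₁)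
  (h : Y₂ ⟶ X₂) (K₁ : X₁.left.IdealSheafData) (K₂ : X₂.left.IdealSheafData)

/-- `Y.hom ≫ 𝟙 = g ≫ X.hom` for a `k`-morphism `g : Y → X` (the square of `pullback.map`).
[folklore] -/
theorem hom_comp_id_eq_left_comp_hom {X Y : SchemeOver k} (g : Y ⟶ X) :
    Y.hom ≫ 𝟙 _ = g.left ≫ X.hom := by
  rw [Category.comp_id, Over.w g]

/-- `X.hom ≫ 𝟙 = 𝟙 ≫ X.hom`. [folklore] -/
theorem hom_comp_id_eq_id_comp_hom (X : SchemeOver k) : X.hom ≫ 𝟙 _ = 𝟙 _ ≫ X.hom := by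
  rw [Category.comp_id, Category.id_comp]

/-! All morphisms between the products are written as `pullback.map`s between the pullbacks
`pullback X₁.hom X₂.hom = (X₁ ⊗ X₂).left` (definitionally; `Over.tensorHom_left`,
`Over.whiskerLeft_left`, `Over.whiskerRight_left` are `rfl`):
* the sub-centre `i₀ = (g₁ ⊗ h).left : Y₁ ⊗ Y₂ → X₁ ⊗ X₂`,
* the ruling `L₀ = (X₁ ◁ h).left : X₁ ⊗ Y₂ → X₁ ⊗ X₂`,
* `q₀ = (g₁ ▷ Y₂).left : Y₁ ⊗ Y₂ → X₁ ⊗ Y₂`, with `q₀ ≫ L₀ = i₀`. -/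

set_option quotPrecheck false in
/-- Local notation: the sub-centre `i₀ = g₁ ⊗ h`. -/
local notation "i₀" => (pullback.map Y₁.hom Y₂.hom X₁.hom X₂.hom g₁.left h.left (𝟙 _)
  (hom_comp_id_eq_left_comp_hom g₁) (hom_comp_id_eq_left_comp_hom h))

set_option quotPrecheck false in
/-- Local notation: the ruling `L₀ = X₁ ◁ h`. -/
local notation "L₀" => (pullback.map X₁.hom Y₂.hom X₁.hom X₂.hom (𝟙 _) h.left (𝟙 _)
  (hom_comp_id_eq_id_comp_hom X₁) (hom_comp_id_eq_left_comp_hom h))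

set_option quotPrecheck false in
/-- Local notation: `q₀ = g₁ ▷ Y₂`. -/
local notation "q₀" => (pullback.map Y₁.hom Y₂.hom X₁.hom Y₂.hom g₁.left (𝟙 _) (𝟙 _)
  (hom_comp_id_eq_left_comp_hom g₁) (hom_comp_id_eq_id_comp_hom Y₂))

set_option quotPrecheck false in
/-- Local notation: the centre `𝓘 = pr₁⁻¹K₁·𝒪 + pr₂⁻¹K₂·𝒪`. -/
local notation "𝓘" => (Scheme.IdealSheafData.comap K₁ (pullback.fst X₁.hom X₂.hom) ⊔
  Scheme.IdealSheafData.comap K₂ (pullback.snd X₁.hom X₂.hom))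

/-- `i₀ = (g₁ ⊗ h).left`, `L₀ = (X₁ ◁ h).left`, `q₀ = (g₁ ▷ Y₂).left` (all `rfl`). [folklore] -/
theorem tensorHom_left_eq : (g₁ ⊗ₘ h).left = i₀ ∧ (X₁ ◁ h).left = L₀ ∧ (g₁ ▷ Y₂).left = q₀ :=
  ⟨rfl, rfl, rfl⟩

/-- `i₀ ≫ pr₁ = pr₁ ≫ g₁`, `i₀ ≫ pr₂ = pr₂ ≫ h`. [folklore] -/
theorem map_fst_snd : i₀ ≫ pullback.fst X₁.hom X₂.hom = pullback.fst Y₁.hom Y₂.hom ≫ g₁.left ∧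
    i₀ ≫ pullback.snd X₁.hom X₂.hom = pullback.snd Y₁.hom Y₂.hom ≫ h.left :=
  ⟨pullback.lift_fst _ _ _, pullback.lift_snd _ _ _⟩

/-- `L₀ ≫ pr₁ = pr₁`, `L₀ ≫ pr₂ = pr₂ ≫ h`. [folklore] -/
theorem ruling_fst_snd : L₀ ≫ pullback.fst X₁.hom X₂.hom = pullback.fst X₁.hom Y₂.hom ∧
    L₀ ≫ pullback.snd X₁.hom X₂.hom = pullback.snd X₁.hom Y₂.hom ≫ h.left :=
  ⟨(pullback.lift_fst _ _ _).trans (Category.comp_id _), pullback.lift_snd _ _ _⟩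

/-- `q₀ ≫ pr₁ = pr₁ ≫ g₁`, `q₀ ≫ pr₂ = pr₂`. [folklore] -/
theorem whisker_fst_snd : q₀ ≫ pullback.fst X₁.hom Y₂.hom = pullback.fst Y₁.hom Y₂.hom ≫ g₁.left ∧
    q₀ ≫ pullback.snd X₁.hom Y₂.hom = pullback.snd Y₁.hom Y₂.hom :=
  ⟨pullback.lift_fst _ _ _, (pullback.lift_snd _ _ _).trans (Category.comp_id _)⟩

/-- `q₀ ≫ L₀ = i₀`. [folklore] -/
theorem map_comp_map_eq : q₀ ≫ L₀ = i₀ := by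
  apply pullback.hom_ext
  · rw [Category.assoc, (ruling_fst_snd X₁ X₂ h).1, (whisker_fst_snd X₁ g₁ (Y₂ := Y₂)).1,
      (map_fst_snd X₁ X₂ g₁ h).1]
  · rw [Category.assoc, (ruling_fst_snd X₁ X₂ h).2, ← Category.assoc,
      (whisker_fst_snd X₁ g₁ (Y₂ := Y₂)).2, (map_fst_snd X₁ X₂ g₁ h).2]

/-- `J ≤ ker f` as soon as `J · 𝒪_X = 0`. [folklore] -/
theorem le_ker_of_comap_eq_bot {X Y : Scheme} (J : Y.IdealSheafData) (f : X ⟶ Y)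
    (hJ : J.comap f = ⊥) : J ≤ f.ker := by
  rw [← Scheme.IdealSheafData.map_bot, Scheme.IdealSheafData.le_map_iff_comap_le, hJ]

/-- **The sub-centre lies in the centre**: `𝓘 ≤ ker (g₁ ⊗ h)` when `K₁ · 𝒪_{Y₁} = 0` and
`K₂ · 𝒪_{Y₂} = 0` (e.g. `K₁ = ker g₁`, `comap_ker_self_eq_bot`). [cite: ShiodaKatsura1979, §1 (1.4)–(1.6)] -/
theorem tensorCentre_le_ker_tensorHom (hK₁ : K₁.comap g₁.left = ⊥) (hK₂ : K₂.comap h.left = ⊥) :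
    𝓘 ≤ Scheme.Hom.ker i₀ := by
  refine sup_le (le_ker_of_comap_eq_bot _ _ ?_) (le_ker_of_comap_eq_bot _ _ ?_)
  · rw [← Scheme.IdealSheafData.comap_comp, (map_fst_snd X₁ X₂ g₁ h).1,
      Scheme.IdealSheafData.comap_comp, hK₁]
    exact (Scheme.IdealSheafData.map_gc _).l_bot
  · rw [← Scheme.IdealSheafData.comap_comp, (map_fst_snd X₁ X₂ g₁ h).2,
      Scheme.IdealSheafData.comap_comp, hK₂]
    exact (Scheme.IdealSheafData.map_gc _).l_bot

/-- **Along the ruling `X₁ ◁ h : X₁ ⊗ Y₂ → X₁ ⊗ X₂` the centre becomes `pr₁⁻¹K₁`**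
(the `K₂`-part dies on `Y₂`). [cite: ShiodaKatsura1979, §1 (1.6)] -/
theorem tensorCentre_comap_ruling (hK₂ : K₂.comap h.left = ⊥) :
    Scheme.IdealSheafData.comap 𝓘 L₀ = K₁.comap (pullback.fst X₁.hom Y₂.hom) := by
  rw [(Scheme.IdealSheafData.map_gc _).l_sup, ← Scheme.IdealSheafData.comap_comp,
    ← Scheme.IdealSheafData.comap_comp, (ruling_fst_snd X₁ X₂ h).1, (ruling_fst_snd X₁ X₂ h).2,
    Scheme.IdealSheafData.comap_comp, hK₂, (Scheme.IdealSheafData.map_gc _).l_bot, sup_bot_eq]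

/-- **`pr₁⁻¹K₁` is an effective Cartier divisor on `X₁ ⊗ Y₂`** if `K₁` is one on `X₁`: on a
product chart `U × V` with `K₁(U) = (u)`, `u` a nonzerodivisor, it is generated by the
nonzerodivisor `u ⊗ 1` of `Γ(U) ⊗ₖ Γ(V)`. [cite: Hartshorne1977, II §6 (flat pull-back of Cartier divisors)] -/
theorem isEffectiveCartier_comap_fst (hK₁ : IsEffectiveCartier K₁) (Y : SchemeOver k) :
    IsEffectiveCartier (K₁.comap (pullback.fst X₁.hom Y.hom)) := by
  intro p
  obtain ⟨U, hpU, u, hu, hKU⟩ := hK₁ (pullback.fst X₁.hom Y.hom p)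
  obtain ⟨V, hV, hpV, -⟩ := exists_isAffineOpen_mem_and_subset
    (x := pullback.snd X₁.hom Y.hom p) (U := ⊤) trivial
  letI := affineOpenAlgebra X₁ U.2
  letI := affineOpenAlgebra Y hV
  obtain ⟨W, hW, hWU, -, e, hset, hfst, -⟩ := exists_ringEquiv_tensorAffineOpen X₁ Y U.2 hV
  have hpW : p ∈ W := by
    rw [← SetLike.mem_coe, hset]
    exact ⟨hpU, hpV⟩
  refine ⟨⟨W, hW⟩, hpW, (pullback.fst X₁.hom Y.hom).appLE U W hWU u, ?_, ?_⟩
  · exact mem_nonZeroDivisors_of_map_ringEquiv e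
      (by rw [hfst]; exact TensorRegularPair.tmul_one_mem_nonZeroDivisors hu)
  · rw [ideal_comap_of_le (pullback.fst X₁.hom Y.hom) K₁ U ⟨W, hW⟩ hWU, hKU, Ideal.map_span,
      Set.image_singleton]

/-- **`𝓘 · 𝒪_{X₁ ⊗ Y₂}` is an effective Cartier divisor** along the ruling (it equals
`pr₁⁻¹K₁`), so the ruling lifts through the blowing up (universal property) — the strict
transform of `X₁ × {pⱼ}` is isomorphic to it. [cite: ShiodaKatsura1979, §1 (1.6) and Thm. 1.7] -/
theorem isEffectiveCartier_tensorCentre_comap_ruling (hK₁ : IsEffectiveCartier K₁)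
    (hK₂ : K₂.comap h.left = ⊥) : IsEffectiveCartier (Scheme.IdealSheafData.comap 𝓘 L₀) := by
  rw [tensorCentre_comap_ruling X₁ X₂ h K₁ K₂ hK₂]
  exact isEffectiveCartier_comap_fst X₁ K₁ hK₁ Y₂

/-- **Regular-pair charts of the centre around every point of the sub-centre**, on which moreover
the second generator dies along the ruling: for `y ∈ Y₁ ⊗ Y₂` there is a product chart
`W = U × V ∋ (g₁ ⊗ h)(y)` with `𝓘(W) = (pr₁^*u, pr₂^*v)` a regular pair in both orders
(`exists_chart_tensorCentre`, from effective Cartier charts of `K₁` and `K₂`) and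
`(X₁ ◁ h)^*(pr₂^*v) = 0`. [cite: ShiodaKatsura1979, §1 (1.4) and Lemma 1.2] -/
theorem exists_charts_tensorCentre_host (hK₁ : IsEffectiveCartier K₁)
    (hK₂ : IsEffectiveCartier K₂) (hK₂h : K₂.comap h.left = ⊥) [IsClosedImmersion h.left]
    (y : ↑(pullback Y₁.hom Y₂.hom)) :
    ∃ (W : (pullback X₁.hom X₂.hom).affineOpens) (u v : Γ(pullback X₁.hom X₂.hom, W)),
      i₀ y ∈ (W : (pullback X₁.hom X₂.hom).Opens) ∧
      Scheme.IdealSheafData.ideal 𝓘 W = Ideal.span {u, v} ∧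
      u ∈ nonZeroDivisors _ ∧ (∀ r, u ∣ r * v → u ∣ r) ∧
      v ∈ nonZeroDivisors _ ∧ (∀ r, v ∣ r * u → v ∣ r) ∧ Scheme.Hom.app L₀ W v = 0 := by
  obtain ⟨U, hyU, u₁, hu₁, hKU⟩ := hK₁ (g₁.left (pullback.fst Y₁.hom Y₂.hom y))
  obtain ⟨V, hyV, v₂, hv₂, hKV⟩ := hK₂ (h.left (pullback.snd Y₁.hom Y₂.hom y))
  obtain ⟨W, hW, hWU, hWV, hset, hideal, hu, hv, huv, hvu⟩ :=
    exists_chart_tensorCentre X₁ X₂ K₁ K₂ U.2 V.2 u₁ v₂ hKU hKV hu₁ hv₂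
  refine ⟨⟨W, hW⟩, _, _, ?_, hideal, hu, huv, hv, hvu, ?_⟩
  · rw [← SetLike.mem_coe, hset]
    constructor
    · change pullback.fst X₁.hom X₂.hom (i₀ y) ∈ (U : Set X₁.left)
      rw [← Scheme.Hom.comp_apply, (map_fst_snd X₁ X₂ g₁ h).1, Scheme.Hom.comp_apply]
      exact hyU
    · change pullback.snd X₁.hom X₂.hom (i₀ y) ∈ (V : Set X₂.left)
      rw [← Scheme.Hom.comp_apply, (map_fst_snd X₁ X₂ g₁ h).2, Scheme.Hom.comp_apply]
      exact hyV
  · -- `L₀^* pr₂^* v₂ = pr₂^* h^* v₂ = 0`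
    have hv0 : h.left.app V v₂ = 0 := by
      have hmem : h.left.appLE V (h.left ⁻¹ᵁ (V : X₂.left.Opens)) le_rfl v₂ ∈
          (K₂.comap h.left).ideal ⟨h.left ⁻¹ᵁ (V : X₂.left.Opens), V.2.preimage h.left⟩ := by
        rw [ideal_comap_of_le h.left K₂ V ⟨_, V.2.preimage h.left⟩ le_rfl, hKV, Ideal.map_span,
          Set.image_singleton]
        exact Ideal.subset_span rfl
      rw [hK₂h] at hmem
      change h.left.appLE V _ le_rfl v₂ ∈ (⊥ : Ideal _) at hmem
      rw [Ideal.mem_bot] at hmem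
      rw [Scheme.Hom.app_eq_appLE]
      exact hmem
    have hWV' : L₀ ⁻¹ᵁ W ≤ (pullback.snd X₁.hom Y₂.hom ≫ h.left) ⁻¹ᵁ (V : X₂.left.Opens) := by
      rw [← (ruling_fst_snd X₁ X₂ h).2]
      exact fun z hz ↦ hWV hz
    have key : (pullback.snd X₁.hom X₂.hom).appLE V W hWV ≫
        Scheme.Hom.appLE L₀ W (L₀ ⁻¹ᵁ W) le_rfl =
        (pullback.snd X₁.hom Y₂.hom ≫ h.left).appLE V (L₀ ⁻¹ᵁ W) hWV' := by
      rw [Scheme.Hom.appLE_comp_appLE]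
      congr 1
      exact (ruling_fst_snd X₁ X₂ h).2
    rw [Scheme.Hom.app_eq_appLE, ← CommRingCat.comp_apply, key,
      ← Scheme.Hom.appLE_comp_appLE _ _ _ (h.left ⁻¹ᵁ (V : X₂.left.Opens)) _ le_rfl
        (fun z hz ↦ hWV' hz), CommRingCat.comp_apply, ← Scheme.Hom.app_eq_appLE, hv0, map_zero]

/-! ## The hosts of a blowing up along the product centre -/

section Host

variable {X' : Scheme} {β : X' ⟶ pullback X₁.hom X₂.hom}

/-- The sub-centre `i₀ = g₁ ⊗ h` is a closed immersion. [folklore] -/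
theorem isClosedImmersion_subcentre [IsClosedImmersion g₁.left] [IsClosedImmersion h.left] :
    IsClosedImmersion i₀ :=
  isClosedImmersion_tensorHom_left g₁ h

/-- **The host `E = X' ×_{X₁ ⊗ X₂} (Y₁ ⊗ Y₂) → Y₁ ⊗ Y₂` is flat and smooth of relative dimension
`1`** (`Resolution/ExceptionalHostSmooth` with the charts `exists_charts_tensorCentre_host`).
[cite: ShiodaKatsura1979, §1 Thm. 1.7 (ii)] -/
theorem flat_and_smoothOfRelativeDimension_one_snd_host (hβ : IsBlowup β 𝓘)
    [IsClosedImmersion g₁.left] [IsClosedImmersion h.left] (hK₁ : IsEffectiveCartier K₁)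
    (hK₁g : K₁.comap g₁.left = ⊥) (hK₂ : IsEffectiveCartier K₂) (hK₂h : K₂.comap h.left = ⊥) :
    Flat (pullback.snd β i₀) ∧ SmoothOfRelativeDimension 1 (pullback.snd β i₀) := by
  haveI := isClosedImmersion_subcentre X₁ X₂ g₁ h
  refine flat_and_smoothOfRelativeDimension_one_snd_exceptionalHost i₀ hβ
    (tensorCentre_le_ker_tensorHom X₁ X₂ g₁ h K₁ K₂ hK₁g hK₂h) fun y ↦ ?_
  obtain ⟨W, u, v, hy, hI, hu, huv, hv, hvu, -⟩ :=
    exists_charts_tensorCentre_host X₁ X₂ g₁ h K₁ K₂ hK₁ hK₂ hK₂h y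
  exact ⟨W, u, v, hy, hI, hu, huv, hv, hvu⟩

/-- **The section `σ : Y₁ ⊗ Y₂ → E` of the host** (the lift of the ruling `X₁ ◁ h` through the
blowing up, restricted along `g₁ ▷ Y₂`; a closed immersion when `β` is separated).
[cite: ShiodaKatsura1979, §1 Thm. 1.7] -/
theorem exists_section_host (hβ : IsBlowup β 𝓘) [IsSeparated β]
    (hK₁ : IsEffectiveCartier K₁) (hK₂h : K₂.comap h.left = ⊥) :
    ∃ σ : pullback Y₁.hom Y₂.hom ⟶ pullback β i₀, σ ≫ pullback.snd β i₀ = 𝟙 _ ∧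
      σ ≫ pullback.fst β i₀ = q₀ ≫ hβ.lift L₀
        (isEffectiveCartier_tensorCentre_comap_ruling X₁ X₂ h K₁ K₂ hK₁ hK₂h) ∧
      IsClosedImmersion σ :=
  exists_section_exceptional i₀ L₀ q₀ hβ _ (map_comp_map_eq X₁ X₂ g₁ h)

/-- **The host is irreducible** (for `Y₁ ⊗ Y₂` integral and `E` reduced).
[cite: ShiodaKatsura1979, §1 Thm. 1.7 (ii)] -/
theorem irreducibleSpace_host (hβ : IsBlowup β 𝓘) [IsClosedImmersion g₁.left]
    [IsClosedImmersion h.left] [IsIntegral ↑(pullback Y₁.hom Y₂.hom)] [IsReduced ↑(pullback β i₀)]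
    (hK₁ : IsEffectiveCartier K₁) (hK₁g : K₁.comap g₁.left = ⊥) (hK₂ : IsEffectiveCartier K₂)
    (hK₂h : K₂.comap h.left = ⊥) {σ : pullback Y₁.hom Y₂.hom ⟶ pullback β i₀}
    (hσ : σ ≫ pullback.fst β i₀ = q₀ ≫ hβ.lift L₀
      (isEffectiveCartier_tensorCentre_comap_ruling X₁ X₂ h K₁ K₂ hK₁ hK₂h)) :
    IrreducibleSpace ↑(pullback β i₀) := by
  haveI := isClosedImmersion_subcentre X₁ X₂ g₁ h
  refine irreducibleSpace_exceptionalHost i₀ hβ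
    (tensorCentre_le_ker_tensorHom X₁ X₂ g₁ h K₁ K₂ hK₁g hK₂h)
    _ (map_comp_map_eq X₁ X₂ g₁ h) hσ fun y ↦ ?_
  obtain ⟨W, u, v, hy, hI, hu, huv, hv, hvu, -⟩ :=
    exists_charts_tensorCentre_host X₁ X₂ g₁ h K₁ K₂ hK₁ hK₂ hK₂h y
  exact ⟨W, u, v, hy, hI, hu, huv, hv, hvu⟩

/-- **Polynomial charts of `E ∖ σ(Y₁ ⊗ Y₂) → Y₁ ⊗ Y₂`** around every point (the shape consumed by
`HodgeTheory/AffineLineBundleCohomology`: `E ∖ σ` is Zariski-locally the affine line over the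
base). [cite: ShiodaKatsura1979, §1 Thm. 1.7 (ii) and §2 Lemma 2.1] -/
theorem exists_polynomial_chart_host (hβ : IsBlowup β 𝓘) [IsClosedImmersion g₁.left]
    [IsClosedImmersion h.left] (hK₁ : IsEffectiveCartier K₁) (hK₁g : K₁.comap g₁.left = ⊥)
    (hK₂ : IsEffectiveCartier K₂) (hK₂h : K₂.comap h.left = ⊥)
    {σ : pullback Y₁.hom Y₂.hom ⟶ pullback β i₀} [IsClosedImmersion σ]
    (hσ : σ ≫ pullback.fst β i₀ = q₀ ≫ hβ.lift L₀
      (isEffectiveCartier_tensorCentre_comap_ruling X₁ X₂ h K₁ K₂ hK₁ hK₂h))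
    (y : ↑(pullback Y₁.hom Y₂.hom)) :
    let O : (pullback β i₀).Opens :=
      (⟨Set.range σ, isClosed_range_section i₀⟩ : TopologicalSpace.Closeds ↑(pullback β i₀)).compl
    ∃ V : (pullback Y₁.hom Y₂.hom).Opens, y ∈ V ∧ IsAffineOpen V ∧
      ∃ (_ : IsAffineOpen ((O.ι ≫ pullback.snd β i₀) ⁻¹ᵁ V))
        (e : Γ(O, (O.ι ≫ pullback.snd β i₀) ⁻¹ᵁ V) ≃+* Polynomial Γ(pullback Y₁.hom Y₂.hom, V)),
        ∀ s, e ((O.ι ≫ pullback.snd β i₀).appLE V _ le_rfl s) = Polynomial.C s := by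
  intro O
  haveI := isClosedImmersion_subcentre X₁ X₂ g₁ h
  obtain ⟨W, u, v, hy, hI, hu, huv, hv, hvu, hv0⟩ :=
    exists_charts_tensorCentre_host X₁ X₂ g₁ h K₁ K₂ hK₁ hK₂ hK₂h y
  obtain ⟨haff, e, he⟩ := exists_polynomial_chart_compl_section i₀ hβ
    (tensorCentre_le_ker_tensorHom X₁ X₂ g₁ h K₁ K₂ hK₁g hK₂h) _ (map_comp_map_eq X₁ X₂ g₁ h) hσ W hI
    hu huv hv hvu hv0
  exact ⟨i₀ ⁻¹ᵁ (W : (pullback X₁.hom X₂.hom).Opens), hy, W.2.preimage i₀, haff, e, he⟩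


/-- **The host is a smooth projective variety of dimension `dim (Y₁ ⊗ Y₂) + 1`** over an
algebraically closed field, for a blowing up `b : X' → X₁ ⊗ X₂` along the centre with `X'`
projective (`Resolution/ExceptionalHostSmooth.isSmoothProjective_exceptionalHost` with the
flatness/smoothness, section and irreducibility above). For Shioda–Katsura: the `ℙ¹`-bundles
`Eⱼ → Bⱼ = Xʳₘ (⊗ W)` of Thm. 1.7 (ii). [cite: ShiodaKatsura1979, §1 Thm. 1.7 (ii)] -/
theorem isSmoothProjective_host [IsAlgClosed k] [IsClosedImmersion g₁.left] [IsClosedImmersion h.left]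
    {X'' : SchemeOver k} (b : X'' ⟶ X₁ ⊗ X₂) (hb : IsBlowup b.left 𝓘) [IsSeparated b.left]
    (hX'' : IsProjectiveOver X'') {d : ℕ} (hB : IsSmoothProjective d (Y₁ ⊗ Y₂))
    (hK₁ : IsEffectiveCartier K₁) (hK₁g : K₁.comap g₁.left = ⊥) (hK₂ : IsEffectiveCartier K₂)
    (hK₂h : K₂.comap h.left = ⊥) :
    IsSmoothProjective (d + 1)
      (Over.mk (pullback.snd b.left (g₁ ⊗ₘ h).left ≫ (Y₁ ⊗ Y₂).hom) : SchemeOver k) := by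
  haveI : IsClosedImmersion (g₁ ⊗ₘ h).left := isClosedImmersion_tensorHom_left g₁ h
  haveI : IsIntegral ↑(pullback Y₁.hom Y₂.hom) := IsSmoothProjective.isIntegral_holds hB
  have hfs := flat_and_smoothOfRelativeDimension_one_snd_host X₁ X₂ g₁ h K₁ K₂ (β := b.left) hb
    hK₁ hK₁g hK₂ hK₂h
  haveI : SmoothOfRelativeDimension 1 (pullback.snd b.left (g₁ ⊗ₘ h).left) := hfs.2
  haveI : @IsSeparated X''.left (pullback X₁.hom X₂.hom) b.left := ‹IsSeparated b.left›
  obtain ⟨σ, -, hσ, -⟩ := exists_section_host X₁ X₂ g₁ h K₁ K₂ (β := b.left) hb hK₁ hK₂h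
  refine isSmoothProjective_exceptionalHost b (g₁ ⊗ₘ h) hB hX'' fun hred ↦ ?_
  exact @irreducibleSpace_host k _ X₁ X₂ Y₁ Y₂ g₁ h K₁ K₂ X''.left b.left hb _ _ _ hred hK₁ hK₁g hK₂
    hK₂h σ hσ

end Host

end Literature.AlgebraicGeometry.Motives

end
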